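import Mathlib
import Summits.Ventures.PercRepro2.Defs

/-!
# FKG and Holley comparisons on a powerset (blind cell PercRepro2, night-2 g5;
proofs/NIGHT2-DARC.md §26)

The two lattice inequalities the k-star proof uses, stated for sums over `Vs.powerset` with
hypotheses restricted to the subsets of `Vs` (Mathlib's `fkg` / `four_functions_theorem_univ` ask
for global hypotheses on the lattice `Finset V`; we extend the weight by `0` outside the powerset
and the data by `L ↦ L ∩ Vs`).

* `fkg_powerset`: for a log-supermodular nonnegative weight `μ` and increasing nonnegative data
  `f, g` on the subsets of `Vs`, `(Σ μ f)(Σ μ g) ≤ (Σ μ)(Σ μ f g)`.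
* `holley_powerset`: if `μ₂` dominates `μ₁` in the Holley sense
  (`μ₁ L * μ₂ L' ≤ μ₁ (L ∩ L') * μ₂ (L ∪ L')`) and `x` is increasing and nonnegative, then
  `(Σ μ₁ x)(Σ μ₂) ≤ (Σ μ₁)(Σ μ₂ x)` — the mean of `x` under `μ₂` dominates its mean under `μ₁`.
-/

namespace Summit.Ventures.PercRepro2.Coin

section Lattice

open Classical

variable {V : Type*} [Fintype V] [DecidableEq V] {R : Type*} [Field R] [LinearOrder R]
  [IsStrictOrderedRing R]

/-- The weight extended by `0` outside the powerset of `Vs`. -/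
noncomputable def extZero (Vs : Finset V) (μ : Finset V → R) : Finset V → R :=
  fun L => if L ⊆ Vs then μ L else 0

/-- The data extended by restriction to `Vs`. -/
def extInter (Vs : Finset V) (x : Finset V → R) : Finset V → R := fun L => x (L ∩ Vs)

omit [Fintype V] [LinearOrder R] [IsStrictOrderedRing R] in
/-- The extended weight agrees with `μ` on the subsets of `Vs`. -/
lemma extZero_of_subset {Vs : Finset V} {μ : Finset V → R} {L : Finset V} (h : L ⊆ Vs) :
    extZero Vs μ L = μ L := by simp [extZero, h]

omit [Fintype V] [LinearOrder R] [IsStrictOrderedRing R] in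
/-- The extended weight vanishes outside the powerset of `Vs`. -/
lemma extZero_of_not_subset {Vs : Finset V} {μ : Finset V → R} {L : Finset V} (h : ¬ L ⊆ Vs) :
    extZero Vs μ L = 0 := by simp [extZero, h]

omit [Fintype V] [Field R] [LinearOrder R] [IsStrictOrderedRing R] in
/-- The extended data agree with `x` on the subsets of `Vs`. -/
lemma extInter_of_subset {Vs : Finset V} {x : Finset V → R} {L : Finset V} (h : L ⊆ Vs) :
    extInter Vs x L = x L := by
  simp [extInter, Finset.inter_eq_left.mpr h]

omit [Fintype V] [IsStrictOrderedRing R] in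
/-- The extended weight is nonnegative when `μ` is nonnegative on the powerset. -/
lemma extZero_nonneg {Vs : Finset V} {μ : Finset V → R} (hμ : ∀ L ⊆ Vs, 0 ≤ μ L) :
    0 ≤ extZero Vs μ := by
  intro L
  by_cases h : L ⊆ Vs
  · rw [extZero_of_subset h]; exact hμ L h
  · rw [extZero_of_not_subset h]; exact (Pi.zero_apply L).le

omit [Fintype V] [IsStrictOrderedRing R] in
/-- The extended data are nonnegative when `x` is nonnegative on the powerset. -/
lemma extInter_nonneg {Vs : Finset V} {x : Finset V → R} (hx : ∀ L ⊆ Vs, 0 ≤ x L) :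
    0 ≤ extInter Vs x := fun _ => hx _ Finset.inter_subset_right

omit [Fintype V] [Field R] [IsStrictOrderedRing R] in
/-- The extended data are monotone when `x` is monotone on the powerset. -/
lemma extInter_monotone {Vs : Finset V} {x : Finset V → R}
    (hx : ∀ L L', L ⊆ L' → L' ⊆ Vs → x L ≤ x L') : Monotone (extInter Vs x) := by
  intro L L' h
  exact hx _ _ (Finset.inter_subset_inter_right h) Finset.inter_subset_right

omit [Fintype V] in
/-- Log-supermodularity of the extended weight. -/
lemma extZero_lsm {Vs : Finset V} {μ : Finset V → R} (hμ0 : ∀ L ⊆ Vs, 0 ≤ μ L)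
    (hμ : ∀ L L', L ⊆ Vs → L' ⊆ Vs → μ L * μ L' ≤ μ (L ∩ L') * μ (L ∪ L')) :
    ∀ L L', extZero Vs μ L * extZero Vs μ L' ≤ extZero Vs μ (L ⊓ L') * extZero Vs μ (L ⊔ L') := by
  intro L L'
  have hnn : 0 ≤ extZero Vs μ (L ⊓ L') * extZero Vs μ (L ⊔ L') :=
    mul_nonneg (extZero_nonneg hμ0 _) (extZero_nonneg hμ0 _)
  by_cases h : L ⊆ Vs
  · by_cases h' : L' ⊆ Vs
    · rw [extZero_of_subset h, extZero_of_subset h', Finset.inf_eq_inter, Finset.sup_eq_union,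
        extZero_of_subset (Finset.inter_subset_left.trans h),
        extZero_of_subset (Finset.union_subset h h')]
      exact hμ L L' h h'
    · rw [extZero_of_not_subset h', mul_zero]; exact hnn
  · rw [extZero_of_not_subset h, zero_mul]; exact hnn

omit [LinearOrder R] [IsStrictOrderedRing R] in
/-- The sum of an extended weight against extended data is the sum over the powerset. -/
lemma sum_extZero_mul (Vs : Finset V) (μ x : Finset V → R) :
    ∑ L, extZero Vs μ L * extInter Vs x L = ∑ L ∈ Vs.powerset, μ L * x L := by
  rw [← Finset.sum_subset (Finset.subset_univ Vs.powerset)]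
  · refine Finset.sum_congr rfl fun L hL => ?_
    have h := Finset.mem_powerset.mp hL
    rw [extZero_of_subset h, extInter_of_subset h]
  · intro L _ hL
    rw [extZero_of_not_subset (fun h => hL (Finset.mem_powerset.mpr h)), zero_mul]

omit [LinearOrder R] [IsStrictOrderedRing R] in
/-- The sum of an extended weight is the sum over the powerset. -/
lemma sum_extZero (Vs : Finset V) (μ : Finset V → R) :
    ∑ L, extZero Vs μ L = ∑ L ∈ Vs.powerset, μ L := by
  have := sum_extZero_mul Vs μ (fun _ => 1)
  simpa [extInter] using this

/-- **FKG on a powerset**: log-supermodular nonnegative weight, increasing nonnegative data. -/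
theorem fkg_powerset (Vs : Finset V) (μ f g : Finset V → R) (hμ0 : ∀ L ⊆ Vs, 0 ≤ μ L)
    (hf0 : ∀ L ⊆ Vs, 0 ≤ f L) (hg0 : ∀ L ⊆ Vs, 0 ≤ g L)
    (hf : ∀ L L', L ⊆ L' → L' ⊆ Vs → f L ≤ f L') (hg : ∀ L L', L ⊆ L' → L' ⊆ Vs → g L ≤ g L')
    (hμ : ∀ L L', L ⊆ Vs → L' ⊆ Vs → μ L * μ L' ≤ μ (L ∩ L') * μ (L ∪ L')) :
    (∑ L ∈ Vs.powerset, μ L * f L) * ∑ L ∈ Vs.powerset, μ L * g L ≤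
      (∑ L ∈ Vs.powerset, μ L) * ∑ L ∈ Vs.powerset, μ L * (f L * g L) := by
  have h := fkg (μ := extZero Vs μ) (f := extInter Vs f) (g := extInter Vs g)
    (extZero_nonneg hμ0) (extInter_nonneg hf0) (extInter_nonneg hg0) (extInter_monotone hf)
    (extInter_monotone hg) (extZero_lsm hμ0 hμ)
  have e : ∀ L, extInter Vs f L * extInter Vs g L = extInter Vs (fun L => f L * g L) L :=
    fun L => rfl
  simp only [e] at h
  rwa [sum_extZero_mul, sum_extZero_mul, sum_extZero, sum_extZero_mul] at h

/-- **Holley comparison on a powerset**: if `μ₂` dominates `μ₁`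
(`μ₁ L * μ₂ L' ≤ μ₁ (L ∩ L') * μ₂ (L ∪ L')`) then the mean of an increasing nonnegative `x`
under `μ₂` dominates its mean under `μ₁`, in the cleared form `(Σ μ₁ x)(Σ μ₂) ≤ (Σ μ₁)(Σ μ₂ x)`. -/
theorem holley_powerset (Vs : Finset V) (μ₁ μ₂ x : Finset V → R) (hμ₁ : ∀ L ⊆ Vs, 0 ≤ μ₁ L)
    (hμ₂ : ∀ L ⊆ Vs, 0 ≤ μ₂ L) (hx0 : ∀ L ⊆ Vs, 0 ≤ x L)
    (hx : ∀ L L', L ⊆ L' → L' ⊆ Vs → x L ≤ x L')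
    (hdom : ∀ L L', L ⊆ Vs → L' ⊆ Vs → μ₁ L * μ₂ L' ≤ μ₁ (L ∩ L') * μ₂ (L ∪ L')) :
    (∑ L ∈ Vs.powerset, μ₁ L * x L) * ∑ L ∈ Vs.powerset, μ₂ L ≤
      (∑ L ∈ Vs.powerset, μ₁ L) * ∑ L ∈ Vs.powerset, μ₂ L * x L := by
  set μ₁' := extZero Vs μ₁ with hμ₁'
  set μ₂' := extZero Vs μ₂ with hμ₂'
  set x' := extInter Vs x with hx'
  have h1 : 0 ≤ μ₁' := extZero_nonneg hμ₁
  have h2 : 0 ≤ μ₂' := extZero_nonneg hμ₂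
  have hx0' : 0 ≤ x' := extInter_nonneg hx0
  have hxm : Monotone x' := extInter_monotone hx
  have hdom' : ∀ L L', μ₁' L * μ₂' L' ≤ μ₁' (L ⊓ L') * μ₂' (L ⊔ L') := by
    intro L L'
    have hnn : 0 ≤ μ₁' (L ⊓ L') * μ₂' (L ⊔ L') := mul_nonneg (h1 _) (h2 _)
    by_cases h : L ⊆ Vs
    · by_cases h' : L' ⊆ Vs
      · rw [hμ₁', hμ₂', extZero_of_subset h, extZero_of_subset h', Finset.inf_eq_inter,
          Finset.sup_eq_union, extZero_of_subset (Finset.inter_subset_left.trans h),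
          extZero_of_subset (Finset.union_subset h h')]
        exact hdom L L' h h'
      · rw [hμ₂', extZero_of_not_subset h', mul_zero]; exact hnn
    · rw [hμ₁', extZero_of_not_subset h, zero_mul]; exact hnn
  have h := four_functions_theorem_univ (f₁ := fun L => μ₁' L * x' L) (f₂ := μ₂') (f₃ := μ₁')
    (f₄ := fun L => μ₂' L * x' L) (fun L => mul_nonneg (h1 L) (hx0' L)) h2 h1
    (fun L => mul_nonneg (h2 L) (hx0' L)) (fun L L' => ?_)
  · rwa [sum_extZero_mul, sum_extZero, sum_extZero, sum_extZero_mul] at h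
  · show μ₁' L * x' L * μ₂' L' ≤ μ₁' (L ⊓ L') * (μ₂' (L ⊔ L') * x' (L ⊔ L'))
    have hxx : x' L ≤ x' (L ⊔ L') := hxm le_sup_left
    calc μ₁' L * x' L * μ₂' L' = (μ₁' L * μ₂' L') * x' L := by ring
      _ ≤ (μ₁' (L ⊓ L') * μ₂' (L ⊔ L')) * x' (L ⊔ L') :=
        mul_le_mul (hdom' L L') hxx (hx0' L) (mul_nonneg (h1 _) (h2 _))
      _ = μ₁' (L ⊓ L') * (μ₂' (L ⊔ L') * x' (L ⊔ L')) := by ring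

end Lattice

end Summit.Ventures.PercRepro2.Coin
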